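import Literature.Computability.ImplicitComplexity.SoftTypeAssignmentFreeVars
import Literature.Computability.ImplicitComplexity.SoftTypeAssignmentTySubst
import HarnessLib

/-!
# `STA₊` derivations with their measures: the weighted typing judgement

GMR08 (= Gaboardi–Marion–Ronchi Della Rocca 2008) bounds the normalisation of a typed term of
`STA₊` by MEASURES of its typing derivation `Π` (GMR08 §3.1, Def. A.1): the degree `d(Π)` (maximal
nesting of `(sp)`), the rank `rk(Π)` (maximal rank of a multiplexor `(m)`) and the weight
`W(Π, r)` ("a static upper bound of the size of all the proofs obtained during the normalization
… in case every box is duplicated at most `r` times"). The tree's judgement `STA.Typing d Γ M σ`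
(file `SoftTypeAssignment.lean`) records the degree only. This file introduces the judgement

* `STA.WTyping r w d Γ M σ` — "`Γ ⊢ M : σ` is derivable in `STA₊` by a derivation of degree `d`,
  all of whose multiplexors have rank `≤ r`, and of weight `W(Π, r) = w`",

with exactly the rules of `STA.Typing` (GMR08 Table 2 + Table 5) and the weight computed rule by
rule: `(Ax) ↦ 1`, `(⊸I) ↦ W + 1`, `(⊸E) ↦ W₁ + W₂ + 1`, `(sp) ↦ r · W`, `(sum) ↦ max W₁ W₂ + 1`,
the administrative rules `(w) (m) (∀I) (∀E)` being weight-neutral. (GMR08 Def. A.1 prints the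
weight for `STA_B`; for `STA₊` the text only says "thanks to a careful definition of the weight"
(before Lemma 5.5) — the `max` at `(sum)` is that definition: it is what makes the weight decrease
along the leftmost evaluation although a linear variable may occur in both branches of a sum.)

Proved here: forgetting the weight gives `STA.Typing` (`WTyping.typing`); the polynomial bound
`W(Π, r) ≤ |M| · r ^ d(Π)` (GMR08 Lemma 5.5 (3) analogue, `WTyping.weight_le`); free variables are
declared (`WTyping.ne_none_of_mem_fv`) and contexts have finite support; admissibility of
weakening by an arbitrary soft type (linear: rule `(w)`; modal: rule `(m)` of rank `0`),
`WTyping.weaken`, `WTyping.weaken_join`. Invariance under injective renaming of the variable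
slots is `SoftTypeAssignmentRemap.lean`; the converse embedding `Typing → WTyping` (normalising
ranks by strengthening) and subject reduction with weight decrease are in later files.

## References

* [GaboardiMarionRonchidellarocca2008] GMR08, Table 2, Table 5, §3.1, Lemma 5.5, Def. A.1.
* [GaboardiRonchiDellaRocca2007] GR07 (the measures and the weight lemmas for `STA`).
-/

namespace Literature.Computability.ImplicitComplexity

namespace STA

/-! ### The weighted judgement -/

/-- `WTyping r w d Γ M σ`: `Γ ⊢ M : σ` in `STA₊` by a derivation `Π` of degree `d(Π) = d`, rank
`rk(Π) ≤ r` (every multiplexor contracts at most `r` slots) and weight `W(Π, r) = w`, where the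
weight is `1` at `(Ax)`, `+1` at `(⊸I)`, `W₁ + W₂ + 1` at `(⊸E)`, `r · W` at `(sp)`,
`max W₁ W₂ + 1` at `(sum)`, and unchanged by `(w)`, `(m)`, `(∀I)`, `(∀E)`. The rules are those of
`STA.Typing` verbatim. [cite: GaboardiMarionRonchidellarocca2008, Table 2, Table 5 and Def. A.1] -/
inductive WTyping (r : ℕ) : ℕ → ℕ → Ctx → Term → SoftTy → Prop
  | ax {Γ : Ctx} {i : ℕ} {A : LinTy} (h : Γ.IsSingleton i ⟨0, A⟩) : WTyping r 1 0 Γ (.var i) ⟨0, A⟩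
  | weak {w d : ℕ} {Γ Γ' : Ctx} {M : Term} {τ : SoftTy} (j : ℕ) (A : LinTy)
      (h : WTyping r w d Γ M τ) (hj : Γ j = none) (hΓ' : Γ' = Function.update Γ j (some ⟨0, A⟩)) :
      WTyping r w d Γ' M τ
  | lam {w d : ℕ} {Γ : Ctx} {M : Term} {k : ℕ} {B A : LinTy}
      (h : WTyping r w d (Ctx.cons (some ⟨k, B⟩) Γ) M ⟨0, A⟩) :
      WTyping r (w + 1) d Γ (.lam M) ⟨0, .limp k B A⟩
  | app {w₁ w₂ d₁ d₂ : ℕ} {Γ Γ₁ Γ₂ : Ctx} {M N : Term} {k : ℕ} {B A : LinTy}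
      (hs : Γ.Split Γ₁ Γ₂) (h₁ : WTyping r w₁ d₁ Γ₁ M ⟨0, .limp k B A⟩)
      (h₂ : WTyping r w₂ d₂ Γ₂ N ⟨k, B⟩) :
      WTyping r (w₁ + w₂ + 1) (max d₁ d₂) Γ (.app M N) ⟨0, A⟩
  | mpx {w d : ℕ} {Γ Γ' : Ctx} {M M' : Term} {μ σ : SoftTy} (S : Finset ℕ) (j : ℕ)
      (h : WTyping r w d Γ M μ) (hS : ∀ i ∈ S, Γ i = some σ) (hj : Γ j = none) (hr : S.card ≤ r)
      (hΓ' : Γ' = Γ.mpx S j σ) (hM' : M' = M.rename (mpxRen S j)) :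
      WTyping r w d Γ' M' μ
  | sp {w d : ℕ} {Γ Γ' : Ctx} {M : Term} {k : ℕ} {A : LinTy}
      (h : WTyping r w d Γ M ⟨k, A⟩) (hΓ' : Γ' = Γ.bang) :
      WTyping r (r * w) (d + 1) Γ' M ⟨k + 1, A⟩
  | allI {w d : ℕ} {Γ Δ : Ctx} {M : Term} {A : LinTy}
      (h : WTyping r w d Δ M ⟨0, A⟩) (hΔ : Δ = Γ.shift) :
      WTyping r w d Γ M ⟨0, .all A⟩
  | allE {w d : ℕ} {Γ : Ctx} {M : Term} {B : LinTy} (A : LinTy)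
      (h : WTyping r w d Γ M ⟨0, .all B⟩) :
      WTyping r w d Γ M ⟨0, B.inst A⟩
  | sum {w₁ w₂ d₁ d₂ : ℕ} {Γ : Ctx} {M N : Term} {A : LinTy}
      (h₁ : WTyping r w₁ d₁ Γ M ⟨0, A⟩) (h₂ : WTyping r w₂ d₂ Γ N ⟨0, A⟩) :
      WTyping r (max w₁ w₂ + 1) (max d₁ d₂) Γ (.sum M N) ⟨0, A⟩

namespace WTyping

variable {r : ℕ}

/-- Forgetting rank bound and weight: a weighted derivation is a derivation of `STA.Typing`.
[cite: GaboardiMarionRonchidellarocca2008, Table 2, Table 5] -/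
theorem typing {w d : ℕ} {Γ : Ctx} {M : Term} {σ : SoftTy} (h : WTyping r w d Γ M σ) :
    Typing d Γ M σ := by
  induction h with
  | ax hΓ => exact Typing.ax hΓ
  | weak j A _ hj hΓ' ih => exact Typing.weak j A ih hj hΓ'
  | lam _ ih => exact Typing.lam ih
  | app hs _ _ ih₁ ih₂ => exact Typing.app hs ih₁ ih₂
  | mpx S j _ hS hj _ hΓ' hM' ih => exact Typing.mpx S j ih hS hj hΓ' hM'
  | sp _ hΓ' ih => exact Typing.sp ih hΓ'
  | allI _ hΔ ih => exact Typing.allI ih hΔ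
  | allE A _ ih => exact Typing.allE A ih
  | sum _ _ ih₁ ih₂ => exact Typing.sum ih₁ ih₂

/-- Transport along an equation between weights (smart cast). [folklore] -/
theorem of_eq_w {w w' d : ℕ} {Γ : Ctx} {M : Term} {σ : SoftTy} (h : WTyping r w d Γ M σ) (e : w = w') :
    WTyping r w' d Γ M σ := e ▸ h

/-- Transport along an equation between degrees (smart cast). [folklore] -/
theorem of_eq_d {w d d' : ℕ} {Γ : Ctx} {M : Term} {σ : SoftTy} (h : WTyping r w d Γ M σ) (e : d = d') :
    WTyping r w d' Γ M σ := e ▸ h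

/-- Transport along an equation between contexts (smart cast). [folklore] -/
theorem of_eq_ctx {w d : ℕ} {Γ Γ' : Ctx} {M : Term} {σ : SoftTy} (h : WTyping r w d Γ M σ) (e : Γ = Γ') :
    WTyping r w d Γ' M σ := e ▸ h

/-- Transport along an equation between terms (smart cast). [folklore] -/
theorem of_eq_tm {w d : ℕ} {Γ : Ctx} {M M' : Term} {σ : SoftTy} (h : WTyping r w d Γ M σ) (e : M = M') :
    WTyping r w d Γ M' σ := e ▸ h

/-! ### The weight is polynomial in the size, exponential in the degree only -/

/-- Weights are positive as soon as `r ≥ 1`. [folklore] -/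
theorem weight_pos (hr : 1 ≤ r) {w d : ℕ} {Γ : Ctx} {M : Term} {σ : SoftTy} (h : WTyping r w d Γ M σ) :
    1 ≤ w := by
  induction h with
  | ax _ => exact le_rfl
  | weak _ _ _ _ _ ih => exact ih
  | lam _ _ => exact Nat.le_add_left 1 _
  | app _ _ _ _ _ => exact Nat.le_add_left 1 _
  | mpx _ _ _ _ _ _ _ _ ih => exact ih
  | sp _ _ ih => exact one_le_mul hr ih
  | allI _ _ ih => exact ih
  | allE _ _ ih => exact ih
  | sum _ _ _ _ => exact Nat.le_add_left 1 _

/-- **`W(Π, r) ≤ |M| · r ^ d(Π)`** for `r ≥ 1`: the weight is polynomial in the size of the subject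
with exponent the degree (GMR08 Lemma 5.5 / GR07 Lemma on measures). [cite: GaboardiMarionRonchidellarocca2008, Lemma 5.5] -/
theorem weight_le (hr : 1 ≤ r) {w d : ℕ} {Γ : Ctx} {M : Term} {σ : SoftTy} (h : WTyping r w d Γ M σ) :
    w ≤ M.size * r ^ d := by
  induction h with
  | ax _ => simp [Term.size]
  | weak _ _ _ _ _ ih => exact ih
  | @lam w d Γ M k B A _ ih =>
    have h1 : 1 ≤ r ^ d := Nat.one_le_pow _ _ hr
    calc w + 1 ≤ M.size * r ^ d + 1 * r ^ d := Nat.add_le_add ih (by simpa using h1)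
      _ = (Term.lam M).size * r ^ d := by simp [Term.size, Nat.add_mul]
  | @app w₁ w₂ d₁ d₂ Γ Γ₁ Γ₂ M N k B A _ _ _ ih₁ ih₂ =>
    have h1 : 1 ≤ r ^ max d₁ d₂ := Nat.one_le_pow _ _ hr
    have e₁ : r ^ d₁ ≤ r ^ max d₁ d₂ := Nat.pow_le_pow_right hr (le_max_left _ _)
    have e₂ : r ^ d₂ ≤ r ^ max d₁ d₂ := Nat.pow_le_pow_right hr (le_max_right _ _)
    calc w₁ + w₂ + 1
        ≤ M.size * r ^ max d₁ d₂ + N.size * r ^ max d₁ d₂ + 1 * r ^ max d₁ d₂ :=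
          Nat.add_le_add (Nat.add_le_add (ih₁.trans (Nat.mul_le_mul_left _ e₁))
            (ih₂.trans (Nat.mul_le_mul_left _ e₂))) (by simpa using h1)
      _ = (Term.app M N).size * r ^ max d₁ d₂ := by simp [Term.size, Nat.add_mul]
  | mpx S j _ _ _ _ _ hM' ih =>
    subst hM'
    rwa [Term.size_rename]
  | @sp w d Γ Γ' M k A _ _ ih =>
    calc r * w ≤ r * (M.size * r ^ d) := Nat.mul_le_mul_left _ ih
      _ = M.size * r ^ (d + 1) := by rw [Nat.pow_succ]; ring
  | allI _ _ ih => exact ih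
  | allE _ _ ih => exact ih
  | @sum w₁ w₂ d₁ d₂ Γ M N A _ _ ih₁ ih₂ =>
    have h1 : 1 ≤ r ^ max d₁ d₂ := Nat.one_le_pow _ _ hr
    have e₁ : r ^ d₁ ≤ r ^ max d₁ d₂ := Nat.pow_le_pow_right hr (le_max_left _ _)
    have e₂ : r ^ d₂ ≤ r ^ max d₁ d₂ := Nat.pow_le_pow_right hr (le_max_right _ _)
    have hw₁ : w₁ ≤ M.size * r ^ max d₁ d₂ := ih₁.trans (Nat.mul_le_mul_left _ e₁)
    have hw₂ : w₂ ≤ N.size * r ^ max d₁ d₂ := ih₂.trans (Nat.mul_le_mul_left _ e₂)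
    calc max w₁ w₂ + 1
        ≤ M.size * r ^ max d₁ d₂ + N.size * r ^ max d₁ d₂ + 1 * r ^ max d₁ d₂ :=
          Nat.add_le_add (max_le (hw₁.trans (Nat.le_add_right _ _))
            (hw₂.trans (Nat.le_add_left _ _))) (by simpa using h1)
      _ = (Term.sum M N).size * r ^ max d₁ d₂ := by simp [Term.size, Nat.add_mul]

/-! ### Free variables are declared; supports are finite -/

/-- A free variable of the subject carries an assumption in the context. [folklore] -/
theorem ne_none_of_mem_fv {w d : ℕ} {Γ : Ctx} {M : Term} {σ : SoftTy} (h : WTyping r w d Γ M σ)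
    {i : ℕ} (hi : i ∈ M.fv) : Γ i ≠ none := by
  induction h generalizing i with
  | ax hΓ =>
    rw [Term.mem_fv_var] at hi
    subst hi
    rw [hΓ.1]
    simp
  | weak j A _ _ hΓ' ih =>
    subst hΓ'
    by_cases hij : i = j
    · subst hij
      simp
    · rw [Function.update_of_ne hij]
      exact ih hi
  | lam _ ih => exact ih (Term.mem_fv_lam.1 hi)
  | app hs _ _ ih₁ ih₂ =>
    rcases Term.mem_fv_app.1 hi with hi | hi
    · exact fun h0 => ih₁ hi ((hs.left_of_ne_none (ih₁ hi)).1.trans h0)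
    · exact fun h0 => ih₂ hi ((hs.right_of_ne_none (ih₂ hi)).2.trans h0)
  | @mpx w d Γ Γ' M M' μ σ S j _ hS hj _ hΓ' hM' ih =>
    subst hΓ' hM'
    obtain ⟨i₀, hi₀, rfl⟩ := Term.mem_fv_rename.1 hi
    have hjS : j ∉ S := fun hjS => by simpa [hj] using hS j hjS
    by_cases hmem : i₀ ∈ S
    · rw [mpxRen_of_mem hmem, Ctx.mpx_self Γ σ hjS]
      simp
    · have hne : i₀ ≠ j := fun e => ih hi₀ (e ▸ hj)
      rw [mpxRen_of_not_mem hmem, Ctx.mpx_of_ne Γ σ hmem hne]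
      exact ih hi₀
  | sp _ hΓ' ih =>
    subst hΓ'
    simpa [Ctx.bang] using ih hi
  | allI _ hΔ ih =>
    subst hΔ
    simpa [Ctx.shift] using ih hi
  | allE A _ ih => exact ih hi
  | sum _ _ ih₁ ih₂ =>
    rcases Term.mem_fv_sum.1 hi with hi | hi
    exacts [ih₁ hi, ih₂ hi]

/-- A slot without assumption is not free in the subject. [folklore] -/
theorem not_mem_fv_of_eq_none {w d : ℕ} {Γ : Ctx} {M : Term} {σ : SoftTy} (h : WTyping r w d Γ M σ)
    {i : ℕ} (hi : Γ i = none) : i ∉ M.fv := fun hm => h.ne_none_of_mem_fv hm hi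

/-- Contexts of derivable judgements have finite support. [folklore] -/
theorem exists_support {w d : ℕ} {Γ : Ctx} {M : Term} {σ : SoftTy} (h : WTyping r w d Γ M σ) :
    ∃ F : Finset ℕ, ∀ i, Γ i ≠ none → i ∈ F := by
  induction h with
  | @ax Γ i A hΓ =>
    refine ⟨{i}, fun j hj => ?_⟩
    by_contra hji
    exact hj (hΓ.2 j (by simpa using hji))
  | weak j A _ _ hΓ' ih =>
    subst hΓ'
    obtain ⟨F, hF⟩ := ih
    refine ⟨insert j F, fun i hi => ?_⟩
    by_cases hij : i = j
    · simp [hij]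
    · rw [Function.update_of_ne hij] at hi
      exact Finset.mem_insert_of_mem (hF i hi)
  | lam _ ih =>
    obtain ⟨F, hF⟩ := ih
    exact ⟨F.image Nat.pred, fun i hi => Finset.mem_image.2 ⟨i + 1, hF (i + 1) hi, rfl⟩⟩
  | app hs _ _ ih₁ ih₂ =>
    obtain ⟨F₁, hF₁⟩ := ih₁
    obtain ⟨F₂, hF₂⟩ := ih₂
    refine ⟨F₁ ∪ F₂, fun i hi => ?_⟩
    rcases hs i with ⟨h₁, _⟩ | ⟨_, h₂⟩
    · exact Finset.mem_union_left _ (hF₁ i (h₁ ▸ hi))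
    · exact Finset.mem_union_right _ (hF₂ i (h₂ ▸ hi))
  | @mpx w d Γ Γ' M M' μ σ S j _ _ _ _ hΓ' _ ih =>
    subst hΓ'
    obtain ⟨F, hF⟩ := ih
    refine ⟨insert j F, fun i hi => ?_⟩
    by_cases hij : i = j
    · simp [hij]
    · by_cases hiS : i ∈ S
      · simp [Ctx.mpx, hiS] at hi
      · rw [Ctx.mpx_of_ne Γ σ hiS hij] at hi
        exact Finset.mem_insert_of_mem (hF i hi)
  | sp _ hΓ' ih =>
    subst hΓ'
    obtain ⟨F, hF⟩ := ih
    exact ⟨F, fun i hi => hF i (by simpa [Ctx.bang] using hi)⟩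
  | allI _ hΔ ih =>
    subst hΔ
    obtain ⟨F, hF⟩ := ih
    exact ⟨F, fun i hi => hF i (by simpa [Ctx.shift] using hi)⟩
  | allE A _ ih => exact ih
  | sum _ _ ih₁ _ => exact ih₁

/-! ### Admissible weakening -/

/-- **Weakening is admissible for every soft type**: a fresh slot may receive any assumption
`x : τ` — by rule `(w)` if `τ` is linear, by a rank-`0` multiplexor if `τ = !τ'` is modal
(GMR08 §2). Weight, degree and rank bound are unchanged. [cite: GaboardiMarionRonchidellarocca2008, §2 and Table 2 ((w), (m))] -/
theorem weaken {w d : ℕ} {Γ : Ctx} {M : Term} {σ : SoftTy} (h : WTyping r w d Γ M σ) {j : ℕ}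
    (hj : Γ j = none) (τ : SoftTy) : WTyping r w d (Function.update Γ j (some τ)) M σ := by
  obtain ⟨k, A⟩ := τ
  cases k with
  | zero => exact WTyping.weak j A h hj rfl
  | succ k =>
    refine WTyping.mpx (σ := ⟨k, A⟩) ∅ j h (by simp) hj (by simp) ?_ ?_
    · rw [Ctx.mpx_empty]
      rfl
    · rw [mpxRen_empty, Term.rename_id]

/-- The union of two contexts, priority to the left. [folklore] -/
def _root_.Literature.Computability.ImplicitComplexity.STA.Ctx.join (Γ Δ : Ctx) : Ctx :=
  fun i => (Γ i).or (Δ i)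

/-- Weakening by a whole finitely-supported context of extra assumptions (slots already declared
in `Γ` keep their assumption). [folklore] -/
theorem weaken_join {w d : ℕ} {Γ : Ctx} {M : Term} {σ : SoftTy} (h : WTyping r w d Γ M σ)
    (Δ : Ctx) (F : Finset ℕ) (hF : ∀ i, Δ i ≠ none → i ∈ F) : WTyping r w d (Γ.join Δ) M σ := by
  induction F using Finset.induction_on generalizing Δ with
  | empty =>
    have : Γ.join Δ = Γ := by
      funext i
      have : Δ i = none := by
        by_contra hne
        simpa using hF i hne
      simp [Ctx.join, this]
    rw [this]
    exact h
  | @insert j F hjF ih =>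
    have hΔ' : ∀ i, Function.update Δ j none i ≠ none → i ∈ F := by
      intro i hi
      by_cases hij : i = j
      · subst hij
        simp at hi
      · rw [Function.update_of_ne hij] at hi
        simpa [hij] using hF i hi
    have h' := ih (Function.update Δ j none) hΔ'
    by_cases hΓj : (Γ.join (Function.update Δ j none)) j = none ∧ Δ j ≠ none
    · obtain ⟨τ, hτ⟩ := Option.ne_none_iff_exists'.1 hΓj.2
      have e : Function.update (Γ.join (Function.update Δ j none)) j (some τ) = Γ.join Δ := by
        funext i
        by_cases hij : i = j
        · subst hij
          have hΓ : Γ i = none := by simpa [Ctx.join] using hΓj.1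
          simp [Ctx.join, hΓ, hτ]
        · simp [Ctx.join, Function.update_of_ne hij]
      exact (h'.weaken hΓj.1 τ).of_eq_ctx e
    · have e : Γ.join (Function.update Δ j none) = Γ.join Δ := by
        funext i
        by_cases hij : i = j
        · subst hij
          rcases not_and_or.1 hΓj with h1 | h2
          · have hΓ : Γ i ≠ none := by simpa [Ctx.join] using h1
            obtain ⟨τ, hτ⟩ := Option.ne_none_iff_exists'.1 hΓ
            simp [Ctx.join, hτ]
          · have : Δ i = none := by simpa using h2
            simp [Ctx.join, this]
        · simp [Ctx.join, Function.update_of_ne hij]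
      exact h'.of_eq_ctx e

end WTyping

end STA

end Literature.Computability.ImplicitComplexity
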